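/-
Copyright (c) 2026 the pub-hodgecm-mathlib formalisation cell (harness21).  Prover seat hodgecm-mathlib-R90-C131-p02 (g0) (R90-TF S4 hand lent to L1
by CHAIR VALVE WORD W4), Track B «K2-LIT», hLiu418 = `stmt-HodgeConjecture-24832`; LEAD F0P6-plan (g14) BATCH #87 (2) (K1a-3-arch), K1-a♮ line lead
K2E5-p16 (g8) WORD #4 (3) «Φ-ROAD» — ED. 3b of the singular row: holomorphy along the K1 lines and the CONTINUATION.  THEOREMS ONLY (no `def`, no
instance, no notation, no named-fact hypothesis, no `sorry`); lane `--supports stmt-HodgeConjecture-24832 --as helper`.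
-/
import Summits.HodgeConjecture.HodgeConjecture.Theorems.K2LiuHermTwoEtaRankOneLetter   -- ★ ED. 3a: majorants, `integrableOn_jIntegrand`, `jIntegral_recursion`
import HarnessLib

/-!
# Crux `HLiu418`, ROAD Φ — the SINGULAR (rank-one) row of the η-sheet, ED. 3b: `s ↦ J_{p,t}(α₀+s, β₀+s)` is holomorphic on `{1 < re(β₀+s)}` and
# `Γ(β−1)⁻¹ · J` CONTINUES along the K1 lines to `{1 − N < re(β₀ + s)}` for every `N`

Cell `hodgecm-mathlib`, crux item hLiu418 = `stmt-HodgeConjecture-24832` (helper lane, count-neutral).  Sequel of ★ `K2LiuHermTwoEtaRankOneLetter`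
(integrability, the recursion `(β−1)·J(α,β) = p·J(α,β+1) − (α−2)·J(α−1,β+1)`) and ★ `K2LiuHermTwoEtaRankOneReduction` (`η₂ = … Γ(α+β−2) · J`,
[Shimura1982, §4 Thm. 4.2] at `n = 2`, `r = 1`).  With the ξ–η identity ★ `xiTwo_eq_etaTwo_of_posSemidef` (`Γ₂(β)⁻¹ = (π Γ(β) Γ(β−1))⁻¹` kills the
poles of `J` at `β ∈ 1 − ℕ`) and ★ p862699 `archSingularBlock_continuation_of_steps`, this is the analytic input that puts the archimedean singular
big-cell block of KIND 1 a♮ on `{0 < re s}` for every `K_w`-type (`N ≥ k/2`).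
* §4 **`hasDerivAt_jIntegral_line`** ∕ `differentiableOn_jIntegral_line` — `s ↦ J(α₀ + s, β₀ + s)` is holomorphic on `{1 < re(β₀ + s)}`
  (Mathlib `hasDerivAt_integral_of_dominated_loc_of_deriv_le` on `(0, ∞)`, majorant `4δ⁻¹ e^{−pr}[(r+2t)^{y₀−2δ} + (r+2t)^{y₀+2δ}][r^{x₀−2δ} + r^{x₀+2δ}]`,
  `δ = (re(β₀+s₀) − 1)/4`; `norm_jIntegrand_log_le`).
* §5 **`exists_continuation_jIntegral_line`** — for every `N : ℕ` and base `(α₀, β₀)` there is `F` HOLOMORPHIC on `{1 − N < re(β₀ + s)}` with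
  `F s = Γ(β₀ + s − 1)⁻¹ · J(α₀ + s, β₀ + s)` on `{1 < re(β₀ + s)}` (induction on `N`: `F_{N+1} = p·F_N^{(α₀,β₀+1)} − (α₀+s−2)·F_N^{(α₀−1,β₀+1)}` by the
  recursion and `Γ(β) = (β−1)Γ(β−1)`, Mathlib `Complex.Gamma_add_one`, `differentiable_one_div_Gamma`).

HONEST LABEL: analytic letters for the arch singular row; closes no socket.  HC_CM is proved only modulo the 7 printed citations (2 remaining named
inputs: hLiu418 = `stmt-HodgeConjecture-24832`, h413 = `stmt-HodgeConjecture-24833`) until rung 0 closes.  REL ≠ ★ ≠ BUILT.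

## References
* [Shimura1982] G. Shimura, *Confluent hypergeometric functions on tube domains*, Math. Ann. 260 (1982), §3 Thm. 3.1, §4 Thm. 4.2.
* [Shimura1997] G. Shimura, *Euler Products and Eisenstein Series*, CBMS 93 (1997), §16.4, §18.4–18.5.
-/

set_option autoImplicit false
set_option linter.dupNamespace false

noncomputable section

open Complex MeasureTheory Set Filter Real
open scoped Topology

namespace Summit.HodgeConjecture.HodgeConjecture.Cruxes.HLiu418.K2LiuHermTwoEtaRankOneContinuation

open Summit.HodgeConjecture.HodgeConjecture.Cruxes.HLiu418.K2LiuHermTwoEtaRankOneLetter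

/-! ## §4 Holomorphy of `s ↦ J(α₀ + s, β₀ + s)` on `{1 < re(β₀ + s)}` -/

/-- norm of the `s`-derivative integrand: `‖e^{−pr}(r+2t)^γ r^δ (log(r+2t) + log r)‖ ≤ e^{−pr}(r+2t)^{re γ} r^{re δ}(|log(r+2t)| + |log r|)`. [folklore] -/
theorem norm_jIntegrand_log_le {p t : ℝ} (ht : 0 < t) (γ δ : ℂ) {r : ℝ} (hr : 0 < r) :
    ‖cexp (-((p * r : ℝ) : ℂ)) * ((((r + 2 * t : ℝ)) : ℂ) ^ γ * ((r : ℝ) : ℂ) ^ δ) *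
        (Complex.log (((r + 2 * t : ℝ)) : ℂ) + Complex.log ((r : ℝ) : ℂ))‖ ≤
      Real.exp (-(p * r)) * ((r + 2 * t) ^ γ.re * r ^ δ.re) * (|Real.log (r + 2 * t)| + |Real.log r|) := by
  have h1 : 0 < r + 2 * t := by positivity
  rw [norm_mul, norm_jIntegrand ht γ δ hr, ← Complex.ofReal_log h1.le, ← Complex.ofReal_log hr.le]
  refine mul_le_mul_of_nonneg_left ?_ (mul_nonneg (Real.exp_pos _).le (mul_nonneg (Real.rpow_nonneg h1.le _) (Real.rpow_nonneg hr.le _)))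
  refine (norm_add_le _ _).trans ?_
  rw [Complex.norm_real, Complex.norm_real, Real.norm_eq_abs, Real.norm_eq_abs]

/-- **`s ↦ J(α₀+s, β₀+s)` HAS A COMPLEX DERIVATIVE at every `s₀` with `1 < re(β₀ + s₀)`** (differentiation under the integral sign on `(0,∞)`,
dominated on the ball of radius `δ = (re(β₀+s₀) − 1)/4` by `4δ⁻¹ e^{−pr}[(r+2t)^{y₀−2δ} + (r+2t)^{y₀+2δ}][r^{x₀−2δ} + r^{x₀+2δ}]`). [Shimura1982, §3] -/
theorem hasDerivAt_jIntegral_line {p t : ℝ} (hp : 0 < p) (ht : 0 < t) (α₀ β₀ : ℂ) {s₀ : ℂ} (hs₀ : 1 < (β₀ + s₀).re) :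
    ∃ D : ℂ, HasDerivAt (fun s : ℂ => ∫ r in Ioi (0 : ℝ), cexp (-((p * r : ℝ) : ℂ)) *
      ((((r + 2 * t : ℝ)) : ℂ) ^ (α₀ + s - 2) * ((r : ℝ) : ℂ) ^ (β₀ + s - 2))) D s₀ := by
  -- radius and exponents
  set δ : ℝ := ((β₀ + s₀).re - 1) / 4 with hδ
  have hδ0 : 0 < δ := by rw [hδ]; linarith
  set x₀ : ℝ := (β₀ + s₀).re - 2 with hx₀
  set y₀ : ℝ := (α₀ + s₀).re - 2 with hy₀
  have hx₀δ : -1 < x₀ - 2 * δ := by rw [hx₀, hδ]; linarith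
  have hx₀δ' : -1 < x₀ + 2 * δ := by rw [hx₀, hδ]; linarith
  -- the functions
  set F : ℂ → ℝ → ℂ := fun s r => cexp (-((p * r : ℝ) : ℂ)) * ((((r + 2 * t : ℝ)) : ℂ) ^ (α₀ + s - 2) * ((r : ℝ) : ℂ) ^ (β₀ + s - 2)) with hF
  set F' : ℂ → ℝ → ℂ := fun s r => cexp (-((p * r : ℝ) : ℂ)) * ((((r + 2 * t : ℝ)) : ℂ) ^ (α₀ + s - 2) * ((r : ℝ) : ℂ) ^ (β₀ + s - 2)) *
    (Complex.log (((r + 2 * t : ℝ)) : ℂ) + Complex.log ((r : ℝ) : ℂ)) with hF'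
  set bound : ℝ → ℝ := fun r => 4 * δ⁻¹ * (Real.exp (-(p * r)) *
    (((r + 2 * t) ^ (y₀ - 2 * δ) + (r + 2 * t) ^ (y₀ + 2 * δ)) * (r ^ (x₀ - 2 * δ) + r ^ (x₀ + 2 * δ)))) with hbound
  -- continuity on `(0, ∞)` (measurability)
  have hcontF : ∀ s : ℂ, ContinuousOn (F s) (Ioi 0) := by
    intro s r hr
    have hr' : (0 : ℝ) < r := hr
    simp only [hF]
    refine ContinuousAt.continuousWithinAt ?_
    refine (by fun_prop : ContinuousAt (fun r : ℝ => cexp (-((p * r : ℝ) : ℂ))) r).mul (ContinuousAt.mul ?_ ?_)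
    · exact ((Complex.continuous_ofReal.comp (by fun_prop : Continuous fun r : ℝ => r + 2 * t)).continuousAt).cpow
        continuousAt_const (Or.inl (by rw [Function.comp_apply, Complex.ofReal_re]; positivity))
    · exact (Complex.continuous_ofReal.continuousAt).cpow continuousAt_const (Or.inl (by rw [Complex.ofReal_re]; exact hr'))
  have hcontF' : ContinuousOn (F' s₀) (Ioi 0) := by
    intro r hr
    have hr' : (0 : ℝ) < r := hr
    have h1 := (hcontF s₀ r hr).continuousAt (Ioi_mem_nhds hr')
    simp only [hF'] at h1 ⊢
    refine ContinuousAt.continuousWithinAt (h1.mul (ContinuousAt.add ?_ ?_))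
    · have hco : Continuous (fun r : ℝ => (((r + 2 * t : ℝ)) : ℂ)) := Complex.continuous_ofReal.comp (continuous_id.add continuous_const)
      exact hco.continuousAt.clog (Complex.ofReal_mem_slitPlane.2 (by positivity))
    · exact Complex.continuous_ofReal.continuousAt.clog (Complex.ofReal_mem_slitPlane.2 hr')
  have hmeas : ∀ s : ℂ, AEStronglyMeasurable (F s) (volume.restrict (Ioi 0)) := fun s =>
    (hcontF s).aestronglyMeasurable measurableSet_Ioi
  -- integrability at `s₀`
  have hint : Integrable (F s₀) (volume.restrict (Ioi 0)) := by
    have h := integrableOn_jIntegrand hp ht (α₀ + s₀ - 2) (δ := β₀ + s₀ - 2) (by simp only [sub_re, re_ofNat]; rw [hx₀] at hx₀δ; linarith)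
    exact h
  -- the bound is integrable
  have hbound_int : Integrable bound (volume.restrict (Ioi 0)) := by
    have h1 := integrableOn_exp_mul_rpow_mul_rpow hp ht (y₀ - 2 * δ) hx₀δ
    have h2 := integrableOn_exp_mul_rpow_mul_rpow hp ht (y₀ - 2 * δ) hx₀δ'
    have h3 := integrableOn_exp_mul_rpow_mul_rpow hp ht (y₀ + 2 * δ) hx₀δ
    have h4 := integrableOn_exp_mul_rpow_mul_rpow hp ht (y₀ + 2 * δ) hx₀δ'
    have h : IntegrableOn (fun r : ℝ => 4 * δ⁻¹ * ((((fun r : ℝ => Real.exp (-(p * r)) * ((r + 2 * t) ^ (y₀ - 2 * δ) * r ^ (x₀ - 2 * δ))) +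
        fun r : ℝ => Real.exp (-(p * r)) * ((r + 2 * t) ^ (y₀ - 2 * δ) * r ^ (x₀ + 2 * δ))) +
        fun r : ℝ => Real.exp (-(p * r)) * ((r + 2 * t) ^ (y₀ + 2 * δ) * r ^ (x₀ - 2 * δ))) +
        fun r : ℝ => Real.exp (-(p * r)) * ((r + 2 * t) ^ (y₀ + 2 * δ) * r ^ (x₀ + 2 * δ))) r) (Ioi 0) :=
      (((h1.add h2).add h3).add h4).const_mul (4 * δ⁻¹)
    change IntegrableOn bound (Ioi 0) volume
    refine h.congr_fun (fun r _ => ?_) measurableSet_Ioi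
    simp only [hbound, Pi.add_apply]
    ring
  -- pointwise derivative
  have hderiv : ∀ r ∈ Ioi (0 : ℝ), ∀ s : ℂ, HasDerivAt (fun s => F s r) (F' s r) s := by
    intro r hr s
    have hr' : (0 : ℝ) < r := hr
    have hc1 : (((r + 2 * t : ℝ)) : ℂ) ≠ 0 := by exact_mod_cast (show (r + 2 * t : ℝ) ≠ 0 by positivity)
    have hc2 : ((r : ℝ) : ℂ) ≠ 0 := by exact_mod_cast hr'.ne'
    have hl1 : HasDerivAt (fun s : ℂ => α₀ + s - 2) 1 s := by
      simpa using ((hasDerivAt_id s).const_add α₀).sub_const 2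
    have hl2 : HasDerivAt (fun s : ℂ => β₀ + s - 2) 1 s := by
      simpa using ((hasDerivAt_id s).const_add β₀).sub_const 2
    have hA := hl1.const_cpow (c := (((r + 2 * t : ℝ)) : ℂ)) (Or.inl hc1)
    have hB := hl2.const_cpow (c := ((r : ℝ) : ℂ)) (Or.inl hc2)
    have hAB := (hA.mul hB).const_mul (cexp (-((p * r : ℝ) : ℂ)))
    simp only [hF, hF']
    refine hAB.congr_deriv ?_
    ring
  -- the domination on the ball
  have hball : ∀ r ∈ Ioi (0 : ℝ), ∀ s ∈ Metric.ball s₀ δ, ‖F' s r‖ ≤ bound r := by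
    intro r hr s hs
    have hr' : (0 : ℝ) < r := hr
    have h1 : 0 < r + 2 * t := by positivity
    have hre : |s.re - s₀.re| < δ := by
      have hd : ‖s - s₀‖ < δ := mem_ball_iff_norm.1 hs
      have := abs_re_le_norm (s - s₀)
      rw [Complex.sub_re] at this
      exact lt_of_le_of_lt this hd
    have hx : x₀ - δ ≤ (β₀ + s - 2).re ∧ (β₀ + s - 2).re ≤ x₀ + δ := by
      simp only [sub_re, add_re, re_ofNat, hx₀]
      constructor <;> linarith [(abs_lt.1 hre).1, (abs_lt.1 hre).2]
    have hy : y₀ - δ ≤ (α₀ + s - 2).re ∧ (α₀ + s - 2).re ≤ y₀ + δ := by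
      simp only [sub_re, add_re, re_ofNat, hy₀]
      constructor <;> linarith [(abs_lt.1 hre).1, (abs_lt.1 hre).2]
    -- abbreviations
    set T : ℝ := (r + 2 * t) ^ (y₀ - 2 * δ) + (r + 2 * t) ^ (y₀ + 2 * δ) with hT
    set R : ℝ := r ^ (x₀ - 2 * δ) + r ^ (x₀ + 2 * δ) with hR
    have hT0 : 0 ≤ T := add_nonneg (Real.rpow_nonneg h1.le _) (Real.rpow_nonneg h1.le _)
    have hR0 : 0 ≤ R := add_nonneg (Real.rpow_nonneg hr'.le _) (Real.rpow_nonneg hr'.le _)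
    -- `(r+2t)^y ≤ T`, `r^x ≤ R`
    have hTy : (r + 2 * t) ^ (α₀ + s - 2).re ≤ T := rpow_le_rpow_add_rpow h1 (by linarith [hy.1]) (by linarith [hy.2])
    have hRx : r ^ (β₀ + s - 2).re ≤ R := rpow_le_rpow_add_rpow hr' (by linarith [hx.1]) (by linarith [hx.2])
    -- `(r+2t)^y |log(r+2t)| ≤ 2δ⁻¹ T`, `r^x |log r| ≤ 2δ⁻¹ R`
    have hTlog : (r + 2 * t) ^ (α₀ + s - 2).re * |Real.log (r + 2 * t)| ≤ 2 * δ⁻¹ * T := by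
      have hl := abs_log_le_rpow_add_rpow h1 hδ0
      have e1 : (r + 2 * t) ^ (α₀ + s - 2).re * (r + 2 * t) ^ δ ≤ T := by
        rw [← Real.rpow_add h1]; exact rpow_le_rpow_add_rpow h1 (by linarith [hy.1]) (by linarith [hy.2])
      have e2 : (r + 2 * t) ^ (α₀ + s - 2).re * (r + 2 * t) ^ (-δ) ≤ T := by
        rw [← Real.rpow_add h1]; exact rpow_le_rpow_add_rpow h1 (by linarith [hy.1]) (by linarith [hy.2])
      calc (r + 2 * t) ^ (α₀ + s - 2).re * |Real.log (r + 2 * t)|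
          ≤ (r + 2 * t) ^ (α₀ + s - 2).re * (δ⁻¹ * ((r + 2 * t) ^ δ + (r + 2 * t) ^ (-δ))) :=
            mul_le_mul_of_nonneg_left hl (Real.rpow_nonneg h1.le _)
        _ = δ⁻¹ * ((r + 2 * t) ^ (α₀ + s - 2).re * (r + 2 * t) ^ δ + (r + 2 * t) ^ (α₀ + s - 2).re * (r + 2 * t) ^ (-δ)) := by ring
        _ ≤ δ⁻¹ * (T + T) := mul_le_mul_of_nonneg_left (add_le_add e1 e2) (inv_nonneg.mpr hδ0.le)
        _ = 2 * δ⁻¹ * T := by ring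
    have hRlog : r ^ (β₀ + s - 2).re * |Real.log r| ≤ 2 * δ⁻¹ * R := by
      have hl := abs_log_le_rpow_add_rpow hr' hδ0
      have e1 : r ^ (β₀ + s - 2).re * r ^ δ ≤ R := by
        rw [← Real.rpow_add hr']; exact rpow_le_rpow_add_rpow hr' (by linarith [hx.1]) (by linarith [hx.2])
      have e2 : r ^ (β₀ + s - 2).re * r ^ (-δ) ≤ R := by
        rw [← Real.rpow_add hr']; exact rpow_le_rpow_add_rpow hr' (by linarith [hx.1]) (by linarith [hx.2])
      calc r ^ (β₀ + s - 2).re * |Real.log r|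
          ≤ r ^ (β₀ + s - 2).re * (δ⁻¹ * (r ^ δ + r ^ (-δ))) := mul_le_mul_of_nonneg_left hl (Real.rpow_nonneg hr'.le _)
        _ = δ⁻¹ * (r ^ (β₀ + s - 2).re * r ^ δ + r ^ (β₀ + s - 2).re * r ^ (-δ)) := by ring
        _ ≤ δ⁻¹ * (R + R) := mul_le_mul_of_nonneg_left (add_le_add e1 e2) (inv_nonneg.mpr hδ0.le)
        _ = 2 * δ⁻¹ * R := by ring
    -- assemble
    have he : 0 < Real.exp (-(p * r)) := Real.exp_pos _
    have hTy0 : 0 ≤ (r + 2 * t) ^ (α₀ + s - 2).re := Real.rpow_nonneg h1.le _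
    have hRx0 : 0 ≤ r ^ (β₀ + s - 2).re := Real.rpow_nonneg hr'.le _
    simp only [hF', hbound]
    refine (norm_jIntegrand_log_le ht (α₀ + s - 2) (β₀ + s - 2) hr').trans ?_
    have key : (r + 2 * t) ^ (α₀ + s - 2).re * r ^ (β₀ + s - 2).re * (|Real.log (r + 2 * t)| + |Real.log r|) ≤ 4 * δ⁻¹ * (T * R) := by
      calc (r + 2 * t) ^ (α₀ + s - 2).re * r ^ (β₀ + s - 2).re * (|Real.log (r + 2 * t)| + |Real.log r|)
          = ((r + 2 * t) ^ (α₀ + s - 2).re * |Real.log (r + 2 * t)|) * r ^ (β₀ + s - 2).re +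
              (r + 2 * t) ^ (α₀ + s - 2).re * (r ^ (β₀ + s - 2).re * |Real.log r|) := by ring
        _ ≤ (2 * δ⁻¹ * T) * R + T * (2 * δ⁻¹ * R) :=
            add_le_add (mul_le_mul hTlog hRx hRx0 (by positivity)) (mul_le_mul hTy hRlog (by positivity) hT0)
        _ = 4 * δ⁻¹ * (T * R) := by ring
    calc Real.exp (-(p * r)) * ((r + 2 * t) ^ (α₀ + s - 2).re * r ^ (β₀ + s - 2).re) * (|Real.log (r + 2 * t)| + |Real.log r|)
        = Real.exp (-(p * r)) * ((r + 2 * t) ^ (α₀ + s - 2).re * r ^ (β₀ + s - 2).re * (|Real.log (r + 2 * t)| + |Real.log r|)) := by ring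
      _ ≤ Real.exp (-(p * r)) * (4 * δ⁻¹ * (T * R)) := mul_le_mul_of_nonneg_left key he.le
      _ = 4 * δ⁻¹ * (Real.exp (-(p * r)) * (T * R)) := by ring
  -- apply dominated differentiation
  have key := hasDerivAt_integral_of_dominated_loc_of_deriv_le (μ := volume.restrict (Ioi 0)) (F := F) (F' := F') (x₀ := s₀)
    (bound := bound) (s := Metric.ball s₀ δ) (Metric.ball_mem_nhds s₀ hδ0) (Eventually.of_forall hmeas) hint
    (hcontF'.aestronglyMeasurable measurableSet_Ioi)
    ((ae_restrict_iff' measurableSet_Ioi).2 (Eventually.of_forall fun r hr s hs => hball r hr s hs)) hbound_int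
    ((ae_restrict_iff' measurableSet_Ioi).2 (Eventually.of_forall fun r hr s _ => hderiv r hr s))
  exact ⟨_, key.2⟩

/-- **HOLOMORPHY OF THE LETTER ALONG THE K1 LINES**: `s ↦ J(α₀ + s, β₀ + s)` is holomorphic on `{1 < re(β₀ + s)}`. [Shimura1982, §3] -/
theorem differentiableOn_jIntegral_line {p t : ℝ} (hp : 0 < p) (ht : 0 < t) (α₀ β₀ : ℂ) :
    DifferentiableOn ℂ (fun s : ℂ => ∫ r in Ioi (0 : ℝ), cexp (-((p * r : ℝ) : ℂ)) *
      ((((r + 2 * t : ℝ)) : ℂ) ^ (α₀ + s - 2) * ((r : ℝ) : ℂ) ^ (β₀ + s - 2))) {s : ℂ | 1 < (β₀ + s).re} := by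
  intro s hs
  obtain ⟨D, hD⟩ := hasDerivAt_jIntegral_line hp ht α₀ β₀ hs
  exact hD.differentiableAt.differentiableWithinAt

/-! ## §5 The continuation of `Γ(β − 1)⁻¹ · J` to `{1 − N < re β}` along the K1 lines -/

/-- **CONTINUATION** ([Shimura1982, §3 Thm. 3.1] in one variable): for every `N : ℕ` and base point `(α₀, β₀)` there is `F` HOLOMORPHIC on
`{1 − N < re(β₀ + s)}` which equals `Γ(β₀ + s − 1)⁻¹ · J(α₀ + s, β₀ + s)` on `{1 < re(β₀ + s)}` (induction on `N`: `F_{N+1}(s) = p·F_N^{(α₀, β₀+1)}(s)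
− (α₀ + s − 2)·F_N^{(α₀−1, β₀+1)}(s)` by §3 and `Γ(β) = (β − 1)Γ(β − 1)`).  Along the K1 line `β = s + 1 − k/2 + n` this reaches `{0 < re s}` for
`N ≥ k/2`. [Shimura1982, §3 Thm. 3.1, §4 Thm. 4.2] -/
theorem exists_continuation_jIntegral_line {p t : ℝ} (hp : 0 < p) (ht : 0 < t) (N : ℕ) (α₀ β₀ : ℂ) :
    ∃ F : ℂ → ℂ, DifferentiableOn ℂ F {s : ℂ | 1 - N < (β₀ + s).re} ∧
      ∀ s : ℂ, 1 < (β₀ + s).re → F s = (Complex.Gamma (β₀ + s - 1))⁻¹ *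
        ∫ r in Ioi (0 : ℝ), cexp (-((p * r : ℝ) : ℂ)) * ((((r + 2 * t : ℝ)) : ℂ) ^ (α₀ + s - 2) * ((r : ℝ) : ℂ) ^ (β₀ + s - 2)) := by
  induction N generalizing α₀ β₀ with
  | zero =>
    refine ⟨fun s => (Complex.Gamma (β₀ + s - 1))⁻¹ *
        ∫ r in Ioi (0 : ℝ), cexp (-((p * r : ℝ) : ℂ)) * ((((r + 2 * t : ℝ)) : ℂ) ^ (α₀ + s - 2) * ((r : ℝ) : ℂ) ^ (β₀ + s - 2)), ?_,
      fun s _ => rfl⟩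
    have hG : Differentiable ℂ (fun s : ℂ => (Complex.Gamma (β₀ + s - 1))⁻¹) :=
      Complex.differentiable_one_div_Gamma.comp (((differentiable_id).const_add β₀).sub_const 1)
    have h := (hG.differentiableOn).mul (differentiableOn_jIntegral_line hp ht α₀ β₀)
    simp only [Nat.cast_zero, sub_zero]
    exact h
  | succ N ih =>
    obtain ⟨F₁, hF₁d, hF₁⟩ := ih α₀ (β₀ + 1)
    obtain ⟨F₂, hF₂d, hF₂⟩ := ih (α₀ - 1) (β₀ + 1)
    refine ⟨fun s => (p : ℂ) * F₁ s - (α₀ + s - 2) * F₂ s, ?_, fun s hs => ?_⟩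
    · -- holomorphy on `{1 − (N+1) < re(β₀ + s)} = {1 − N < re(β₀ + 1 + s)}`
      have hsub : {s : ℂ | 1 - ((N + 1 : ℕ) : ℝ) < (β₀ + s).re} ⊆ {s : ℂ | 1 - (N : ℝ) < (β₀ + 1 + s).re} := by
        intro s hs
        simp only [mem_setOf_eq, add_re, one_re, Nat.cast_add, Nat.cast_one] at hs ⊢
        linarith
      have hlin : Differentiable ℂ (fun s : ℂ => α₀ + s - 2) := ((differentiable_id).const_add α₀).sub_const 2
      exact ((differentiableOn_const _).mul (hF₁d.mono hsub)).sub (hlin.differentiableOn.mul (hF₂d.mono hsub))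
    · -- the recursion on `{1 < re(β₀ + s)}`
      have hs1 : 1 < (β₀ + 1 + s).re := by simp only [add_re, one_re] at hs ⊢; linarith
      have hβ1 : β₀ + s - 1 ≠ 0 := fun h => by
        have := congrArg Complex.re h; simp only [sub_re, add_re, one_re, zero_re] at this hs; linarith
      have hΓ : Complex.Gamma (β₀ + s - 1) ≠ 0 :=
        Complex.Gamma_ne_zero_of_re_pos (by simp only [sub_re, add_re, one_re] at hs ⊢; linarith)
      have hrec := jIntegral_recursion hp ht (α₀ + s) (β := β₀ + s) hs
      simp only
      rw [hF₁ s hs1, hF₂ s hs1]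
      -- normalise exponents and Gamma arguments
      have e1 : β₀ + 1 + s - 1 = (β₀ + s - 1) + 1 := by ring
      have e2 : β₀ + 1 + s - 2 = β₀ + s + 1 - 2 := by ring
      have e3 : α₀ - 1 + s - 2 = α₀ + s - 1 - 2 := by ring
      have e4 : β₀ + s - 1 = β₀ + s - 1 := rfl
      rw [e1, Complex.Gamma_add_one _ hβ1]
      simp only [e2, e3]
      rw [show α₀ + s - 2 = α₀ + s - 2 from rfl] at hrec
      -- `hrec : (β−1)·J(α,β) = p·J(α,β+1) − (α−2)·J(α−1,β+1)` with `α = α₀+s`, `β = β₀+s`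
      have hinv : ((β₀ + s - 1) * Complex.Gamma (β₀ + s - 1))⁻¹ = (Complex.Gamma (β₀ + s - 1))⁻¹ * (β₀ + s - 1)⁻¹ := by
        rw [mul_inv, mul_comm]
      rw [hinv]
      have hJ : (∫ r in Ioi (0 : ℝ), cexp (-((p * r : ℝ) : ℂ)) * ((((r + 2 * t : ℝ)) : ℂ) ^ (α₀ + s - 2) * ((r : ℝ) : ℂ) ^ (β₀ + s - 2))) =
          (β₀ + s - 1)⁻¹ * ((p : ℂ) * (∫ r in Ioi (0 : ℝ), cexp (-((p * r : ℝ) : ℂ)) * ((((r + 2 * t : ℝ)) : ℂ) ^ (α₀ + s - 2) * ((r : ℝ) : ℂ) ^ (β₀ + s + 1 - 2))) -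
            (α₀ + s - 2) * (∫ r in Ioi (0 : ℝ), cexp (-((p * r : ℝ) : ℂ)) * ((((r + 2 * t : ℝ)) : ℂ) ^ (α₀ + s - 1 - 2) * ((r : ℝ) : ℂ) ^ (β₀ + s + 1 - 2)))) := by
        rw [← hrec, ← mul_assoc, inv_mul_cancel₀ hβ1, one_mul]
      rw [hJ]
      ring


end Summit.HodgeConjecture.HodgeConjecture.Cruxes.HLiu418.K2LiuHermTwoEtaRankOneContinuation

end
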